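import Literature.NumberTheory.Transcendental.ComplexFormsProofs
import Mathlib.LinearAlgebra.Matrix.SchurComplement
import HarnessLib

/-!
# Complex forms of top type `(n,0)`: `Λ^{n,0} = ℂ · dz₁ ∧ ⋯ ∧ dz_n`, and `dz ∧ dz̄ ≠ 0`

Topic: complex-valued forms on complex manifolds (`Literature/NumberTheory/Transcendental/ComplexForms.lean`,
whose predicate `IsOfType p q` is the pointwise weight condition
`α(e^{iθ}v₁, …, e^{iθ}v_k) = e^{i(p-q)θ} α(v₁, …, v_k)`). This file proves the fibrewise linear
algebra of forms of *top* type on a complex vector space `E` of dimension `n`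
(Voisin (2002), §2.3.1: `Ω^{1,0}` is the bundle of `ℂ`-linear forms, `Ω^{p,q} = Λ^p Ω^{1,0} ⊗ Λ^q Ω^{0,1}`
with local generators `dz_I ∧ dz̄_J`; so `Ω^{n,0}` is the line spanned by `dz₁ ∧ ⋯ ∧ dz_n`), for the
tree's carriers (real continuous alternating maps `E [⋀^Fin n]→L[ℝ] ℂ`, the shuffle wedge
`ContinuousAlternatingMap.wedge` of `FormsAlgebra.lean`). It is the pointwise input of the positivity
argument `∫_X i^{n²} η ∧ η̄ > 0` for non-zero holomorphic `n`-forms (Voisin (2002), proof of Cor. 7.6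
for `p = n`; consumer: `Literature.AlgebraicGeometry.HodgeTheory.Voisin2002_closedForm_top_zero_not_exact`).

## Main statements (all proved)

* `apply_update_zero_I_smul_of_weight`, `apply_update_I_smul_of_weight`: a real-alternating
  `(m+1)`-form of weight `m+1` is `ℂ`-linear in every slot (`φ(…, iv_j, …) = i φ(v)`).
* `cdetL e`: the complex determinant form `dz₁ ∧ ⋯ ∧ dz_n` of a complex basis `e` as a real
  continuous alternating map; `eq_smul_cdetL_of_weight`: **a form of weight `n` in `n` slots is
  `φ(e) · cdetL e`** (`Λ^{n,0} E^* = ℂ · det_e`).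
* `wedge_cdetL_conj_apply_append`: **`(det_e ∧ \overline{det_e})(e, ie) = (-2i)^n`**, in particular
  `det_e ∧ \overline{det_e} ≠ 0` (`wedge_cdetL_conj_ne_zero`); via the permutation-sum form of the
  generalised Laplace expansion `sum_perm_sign_smul_leibniz_blocks` and the block determinant
  `det (1, i; 1, -i) = (-2i)^n` (`Matrix.det_fromBlocks_one₁₁`).
* `reCLM_wedge_conj_smul_cdetL`, `reCLM_wedge_conj_cdetL_apply_append_pos`: for `φ = a · det_e`, the
  real top form `Re(c₀ · φ ∧ φ̄)` is `|a|²` times the fixed form `Re(c₀ · det_e ∧ \overline{det_e})`,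
  which for `c₀ = \overline{(-2i)^n}` is positive (`= 4^n`) on the real basis `(e, ie)`.

## Proof of the `ℂ`-linearity (vs. the literature)

In the literature `Λ^{n,0} ⊂ Λ^n_ℝ E^* ⊗ ℂ` is *defined* as `Λ^n (E^{1,0})^*` and the weight
description is a remark; here the weight condition is the definition (`IsOfType`), so we prove:
if `φ(e^{iθ}v) = e^{i(m+1)θ} φ(v)` for all `θ`, `v`, then `φ(iv₀, v₁, …) = i φ(v₀, v₁, …)`. The function
`h(θ) = φ(v₀, e^{iθ}v₁, …, e^{iθ}v_m)` is a trigonometric polynomial with frequencies in `[-m, m]`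
(`exists_fourier_multilinear` of `ComplexFormsProofs`, `m` rotating slots), while the weight
condition at `v` and at `(iv₀, v₁, …)` and real-linearity in the first slot give
`h(θ) = e^{i(m+1)θ}(cos θ · a - sin θ · b) = ½ e^{i(m+2)θ}(a + ib) + ½ e^{imθ}(a - ib)` with `a = φ(v)`,
`b = φ(iv₀, …)`; the coefficient of the too-high frequency `m + 2` is extracted by the finite
Fourier average over the `(2m+5)`-th roots of unity (`sum_exp_mul_rootAngle_mul_I_eq_zero`), whence
`a + ib = 0`. The other slots follow by a transposition, and `ℂ`-multilinear alternating `n`-forms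
are multiples of `det_e` (`AlternatingMap.eq_smul_basis_det`).

## References

* C. Voisin, *Hodge Theory and Complex Algebraic Geometry I*, Cambridge Stud. Adv. Math. 76 (2002),
  §2.3.1 (eq. (2.2), (2.4); `Ω^{1,0}` = `ℂ`-linear forms; generators `dz_I ∧ dz̄_J`), Cor. 7.6.
* R. O. Wells, *Differential Analysis on Complex Manifolds*, GTM 65 (1980), Ch. I §3.
* Mathlib: `Mathlib/LinearAlgebra/Determinant.lean` (`AlternatingMap.eq_smul_basis_det`,
  `Basis.det_apply`), `Mathlib/LinearAlgebra/Matrix/SchurComplement.lean` (`det_fromBlocks_one₁₁`).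
-/

noncomputable section

open scoped Manifold ContDiff Topology
open Set Function Finset

namespace Literature.NumberTheory.Transcendental

/-! ### Complex exponentials of integer frequencies -/

section ExpAlgebra

/-- `e^{ipθ} e^{iqθ} = e^{i(p+q)θ}` for integer frequencies. [folklore] -/
theorem cexp_int_mul_mul_cexp_int_mul (p q : ℤ) (θ : ℝ) :
    Complex.exp ((p : ℂ) * θ * Complex.I) * Complex.exp ((q : ℂ) * θ * Complex.I) =
      Complex.exp (((p + q : ℤ) : ℂ) * θ * Complex.I) := by
  rw [← Complex.exp_add]
  congr 1
  push_cast
  ring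

/-- Euler: `cos θ = (e^{iθ} + e^{-iθ})/2` with integer-frequency exponentials. [folklore] -/
theorem ofReal_cos_eq_cexp (θ : ℝ) :
    (Real.cos θ : ℂ) = (Complex.exp (((1 : ℤ) : ℂ) * θ * Complex.I) +
      Complex.exp (((-1 : ℤ) : ℂ) * θ * Complex.I)) / 2 := by
  rw [Complex.ofReal_cos, Complex.cos]
  push_cast
  ring_nf

/-- Euler: `sin θ = (e^{-iθ} - e^{iθ}) i/2` with integer-frequency exponentials. [folklore] -/
theorem ofReal_sin_eq_cexp (θ : ℝ) :
    (Real.sin θ : ℂ) = (Complex.exp (((-1 : ℤ) : ℂ) * θ * Complex.I) -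
      Complex.exp (((1 : ℤ) : ℂ) * θ * Complex.I)) * Complex.I / 2 := by
  rw [Complex.ofReal_sin, Complex.sin]
  push_cast
  ring_nf

/-- `e^{i·0·θ} = 1`. [folklore] -/
theorem cexp_int_zero_mul (θ : ℝ) : Complex.exp (((0 : ℤ) : ℂ) * θ * Complex.I) = 1 := by
  simp

end ExpAlgebra

/-! ### Forms of top weight are complex-linear in each slot -/

section TopWeight

variable {E : Type*} [NormedAddCommGroup E] [NormedSpace ℂ E] {m n : ℕ}

/-- **A real-alternating `(m+1)`-form of weight `m+1` is `ℂ`-linear in the first slot.** If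
`φ(e^{iθ}v₀, …, e^{iθ}v_m) = e^{i(m+1)θ} φ(v)` for all `θ` and `v`, then `φ(iv₀, v₁, …) = i φ(v)`.
Proof: `h(θ) = φ(v₀, e^{iθ}v₁, …, e^{iθ}v_m)` is a trigonometric polynomial with frequencies in
`[-m, m]` (`exists_fourier_multilinear`), while the weight condition at `v` and at
`(iv₀, v₁, …)` and real-linearity in the first slot give
`h(θ) = e^{i(m+1)θ}(cos θ · a - sin θ · b) = e^{i(m+2)θ}(a/2 + ib/2) + e^{imθ}(a/2 - ib/2)`
(`a = φ(v)`, `b = φ(iv₀, …)`); extracting the coefficient of `e^{i(m+2)θ}` by the finite Fourier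
average over the `(2m+5)`-th roots of unity (`sum_exp_mul_rootAngle_mul_I_eq_zero`) gives
`a + ib = 0`, i.e. `b = ia`. This is the statement `Λ^{k,0} = Λ^k_ℂ (T^{1,0})^*`
(Voisin (2002), §2.3.1; Wells (1980), Ch. I §3) for `k` the number of slots. [cite: VoisinHodgeI2002, §2.3.1] -/
theorem apply_update_zero_I_smul_of_weight (φ : E [⋀^Fin (m + 1)]→L[ℝ] ℂ)
    (hφ : ∀ (θ : ℝ) (v : Fin (m + 1) → E), φ (fun i ↦ Complex.exp (θ * Complex.I) • v i) =
      Complex.exp (((m + 1 : ℕ) : ℂ) * θ * Complex.I) * φ v)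
    (v : Fin (m + 1) → E) :
    φ (update v 0 (Complex.I • v 0)) = Complex.I * φ v := by
  set a := φ v with ha
  set b := φ (update v 0 (Complex.I • v 0)) with hb
  -- the two auxiliary functions of `θ`
  set H : ℝ → ℂ := fun θ ↦ φ (Fin.cons (v 0) fun i ↦ Complex.exp (θ * Complex.I) • v i.succ)
    with hH
  set H' : ℝ → ℂ := fun θ ↦
    φ (Fin.cons (Complex.I • v 0) fun i ↦ Complex.exp (θ * Complex.I) • v i.succ) with hH'
  -- (1) `H` is a trigonometric polynomial with frequencies in `[-m, m]`
  obtain ⟨P, hP, hPH⟩ := exists_fourier_multilinear m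
    (φ.toContinuousMultilinearMap.toMultilinearMap.curryLeft (v 0)) (fun i ↦ v i.succ)
  have hPH' : ∀ θ : ℝ, H θ = ∑ m' ∈ P.coeff.support,
      P.coeff m' * Complex.exp ((m' : ℂ) * θ * Complex.I) := fun θ ↦ by
    rw [← hPH θ, MultilinearMap.curryLeft_apply]
    rfl
  -- (2) the weight condition: `H θ = e^{i(m+1)θ} (cos θ a - sin θ b)`
  have hrot : ∀ (w : E) (θ : ℝ), (fun i : Fin (m + 1) ↦ Complex.exp (θ * Complex.I) •
      (Fin.cons w (fun i ↦ v i.succ) : Fin (m + 1) → E) i) =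
      Fin.cons (Real.cos θ • w + Real.sin θ • (Complex.I • w))
        (fun i ↦ Complex.exp (θ * Complex.I) • v i.succ) := by
    intro w θ
    funext i
    refine Fin.cases ?_ (fun j ↦ ?_) i
    · simp only [Fin.cons_zero, exp_mul_I_smul_eq]
    · simp only [Fin.cons_succ]
  have hv : v = Fin.cons (v 0) (fun i ↦ v i.succ) := by
    funext i; refine Fin.cases rfl (fun j ↦ rfl) i
  have hv' : update v 0 (Complex.I • v 0) = Fin.cons (Complex.I • v 0) (fun i ↦ v i.succ) := by
    funext i; refine Fin.cases (by simp) (fun j ↦ ?_) i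
    rw [update_of_ne (Fin.succ_ne_zero j), Fin.cons_succ]
  have hw1 : ∀ θ : ℝ, Complex.exp (((m + 1 : ℕ) : ℂ) * θ * Complex.I) * a =
      (Real.cos θ : ℂ) * H θ + (Real.sin θ : ℂ) * H' θ := by
    intro θ
    have h := hφ θ v
    conv_lhs at h => rw [hv, hrot]
    rw [← h, show φ (Fin.cons (Real.cos θ • v 0 + Real.sin θ • (Complex.I • v 0))
        fun i ↦ Complex.exp (θ * Complex.I) • v i.succ) =
      φ.toContinuousMultilinearMap (Fin.cons (Real.cos θ • v 0 + Real.sin θ • (Complex.I • v 0))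
        fun i ↦ Complex.exp (θ * Complex.I) • v i.succ) from rfl,
      ContinuousMultilinearMap.cons_add, ContinuousMultilinearMap.cons_smul,
      ContinuousMultilinearMap.cons_smul]
    simp only [hH, hH', Complex.real_smul]
    rfl
  have hw2 : ∀ θ : ℝ, Complex.exp (((m + 1 : ℕ) : ℂ) * θ * Complex.I) * b =
      (Real.cos θ : ℂ) * H' θ - (Real.sin θ : ℂ) * H θ := by
    intro θ
    have h := hφ θ (update v 0 (Complex.I • v 0))
    conv_lhs at h => rw [hv', hrot]
    have hI : Real.cos θ • (Complex.I • v 0) + Real.sin θ • (Complex.I • (Complex.I • v 0)) =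
        Real.cos θ • (Complex.I • v 0) + (-Real.sin θ) • v 0 := by
      rw [← mul_smul, Complex.I_mul_I, neg_smul, one_smul, smul_neg, neg_smul]
    rw [← h, hI, show φ (Fin.cons (Real.cos θ • (Complex.I • v 0) + (-Real.sin θ) • v 0)
        fun i ↦ Complex.exp (θ * Complex.I) • v i.succ) =
      φ.toContinuousMultilinearMap (Fin.cons (Real.cos θ • (Complex.I • v 0) + (-Real.sin θ) • v 0)
        fun i ↦ Complex.exp (θ * Complex.I) • v i.succ) from rfl,
      ContinuousMultilinearMap.cons_add, ContinuousMultilinearMap.cons_smul,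
      ContinuousMultilinearMap.cons_smul]
    simp only [hH, hH', Complex.real_smul]
    push_cast
    ring_nf
    rfl
  have hHθ : ∀ θ : ℝ, H θ = Complex.exp (((m + 1 : ℕ) : ℂ) * θ * Complex.I) *
      ((Real.cos θ : ℂ) * a - (Real.sin θ : ℂ) * b) := by
    intro θ
    have h1 := hw1 θ
    have h2 := hw2 θ
    have hcs : (Real.cos θ : ℂ) ^ 2 + (Real.sin θ : ℂ) ^ 2 = 1 := by
      exact_mod_cast Real.cos_sq_add_sin_sq θ
    linear_combination -(Real.cos θ : ℂ) * h1 + (Real.sin θ : ℂ) * h2 - H θ * hcs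
  -- (3) Fourier average over the `(2k+1)`-st roots of unity, `k = m + 2`, against `e^{-i(m+2)θ}`
  set k : ℕ := m + 2 with hk
  set θs : Fin (2 * k + 1) → ℝ := fun j ↦ 2 * Real.pi * j / (2 * k + 1) with hθs
  have hS1 : ∑ j : Fin (2 * k + 1), Complex.exp (((-(m + 2 : ℕ) : ℤ) : ℂ) * θs j * Complex.I) *
      H (θs j) = 0 := by
    simp only [hPH', Finset.mul_sum]
    rw [Finset.sum_comm]
    refine Finset.sum_eq_zero fun m' hm' ↦ ?_
    have hm := hP m' hm'
    have hterm : ∀ j : Fin (2 * k + 1),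
        Complex.exp (((-(m + 2 : ℕ) : ℤ) : ℂ) * θs j * Complex.I) *
          (P.coeff m' * Complex.exp ((m' : ℂ) * θs j * Complex.I)) =
        P.coeff m' * Complex.exp (((-(m + 2 : ℕ) + m' : ℤ) : ℂ) * θs j * Complex.I) := by
      intro j
      rw [← cexp_int_mul_mul_cexp_int_mul]
      ring
    simp only [hterm, ← Finset.mul_sum]
    rw [sum_exp_mul_rootAngle_mul_I_eq_zero (k := k) (by omega) (by omega), mul_zero]
  have hS2 : ∑ j : Fin (2 * k + 1), Complex.exp (((-(m + 2 : ℕ) : ℤ) : ℂ) * θs j * Complex.I) *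
      H (θs j) = (2 * k + 1 : ℕ) * ((a + Complex.I * b) / 2) := by
    have hterm : ∀ θ : ℝ, Complex.exp (((-(m + 2 : ℕ) : ℤ) : ℂ) * θ * Complex.I) * H θ =
        (a + Complex.I * b) / 2 +
          Complex.exp (((-2 : ℤ) : ℂ) * θ * Complex.I) * ((a - Complex.I * b) / 2) := by
      intro θ
      rw [hHθ, ofReal_cos_eq_cexp, ofReal_sin_eq_cexp,
        show (((m + 1 : ℕ) : ℂ) * θ * Complex.I) = ((m + 1 : ℕ) : ℤ) * θ * Complex.I by push_cast; ring]
      have e1 := cexp_int_mul_mul_cexp_int_mul (-(m + 2 : ℕ)) ((m + 1 : ℕ)) θ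
      rw [show (-(m + 2 : ℕ) + (m + 1 : ℕ) : ℤ) = -1 by omega] at e1
      have e2 : Complex.exp (((-1 : ℤ) : ℂ) * θ * Complex.I) *
          Complex.exp (((1 : ℤ) : ℂ) * θ * Complex.I) = 1 := by
        rw [cexp_int_mul_mul_cexp_int_mul, show ((-1 : ℤ) + 1) = 0 by norm_num, cexp_int_zero_mul]
      have e3 : Complex.exp (((-1 : ℤ) : ℂ) * θ * Complex.I) *
          Complex.exp (((-1 : ℤ) : ℂ) * θ * Complex.I) =
          Complex.exp (((-2 : ℤ) : ℂ) * θ * Complex.I) := by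
        rw [cexp_int_mul_mul_cexp_int_mul, show ((-1 : ℤ) + -1) = -2 by norm_num]
      linear_combination ((Complex.exp (((1 : ℤ) : ℂ) * θ * Complex.I) +
          Complex.exp (((-1 : ℤ) : ℂ) * θ * Complex.I)) / 2 * a -
        (Complex.exp (((-1 : ℤ) : ℂ) * θ * Complex.I) -
          Complex.exp (((1 : ℤ) : ℂ) * θ * Complex.I)) * Complex.I / 2 * b) * e1 +
        (a / 2 + Complex.I * b / 2) * e2 + (a / 2 - Complex.I * b / 2) * e3
    simp only [hterm, Finset.sum_add_distrib, Finset.sum_const, Finset.card_univ, Fintype.card_fin,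
      nsmul_eq_mul, ← Finset.sum_mul]
    rw [sum_exp_mul_rootAngle_mul_I_eq_zero (k := k) (by omega) (by omega), zero_mul, add_zero]
  -- conclusion
  have hN : ((2 * k + 1 : ℕ) : ℂ) ≠ 0 := Nat.cast_ne_zero.2 (by omega)
  have hab : (a + Complex.I * b) / 2 = 0 := by
    have := hS1.symm.trans hS2
    exact (mul_eq_zero.1 this.symm).resolve_left hN
  have hI2 : Complex.I * Complex.I = -1 := Complex.I_mul_I
  linear_combination (-2 * Complex.I) * hab + b * hI2

/-- **A real-alternating `(m+1)`-form of weight `m+1` is `ℂ`-linear in every slot**: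
`φ(…, iv_j, …) = i φ(v)` (from the first slot by the transposition `(0 j)`, under which `φ` is
odd and the weight condition invariant). Voisin (2002), §2.3.1. [cite: VoisinHodgeI2002, §2.3.1] -/
theorem apply_update_I_smul_of_weight (φ : E [⋀^Fin (m + 1)]→L[ℝ] ℂ)
    (hφ : ∀ (θ : ℝ) (v : Fin (m + 1) → E), φ (fun i ↦ Complex.exp (θ * Complex.I) • v i) =
      Complex.exp (((m + 1 : ℕ) : ℂ) * θ * Complex.I) * φ v)
    (v : Fin (m + 1) → E) (j : Fin (m + 1)) :
    φ (update v j (Complex.I • v j)) = Complex.I * φ v := by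
  rcases eq_or_ne j 0 with rfl | hj
  · exact apply_update_zero_I_smul_of_weight φ hφ v
  · have hswap : ∀ w : Fin (m + 1) → E, φ (w ∘ Equiv.swap 0 j) = -φ w := fun w ↦
      φ.toAlternatingMap.map_swap w hj.symm
    set v' : Fin (m + 1) → E := v ∘ Equiv.swap 0 j with hv'
    have h1 : update v j (Complex.I • v j) ∘ Equiv.swap (0 : Fin (m + 1)) j =
        update v' 0 (Complex.I • v' 0) := by
      rw [update_comp_equiv, Equiv.symm_swap, Equiv.swap_apply_right, hv', Function.comp_apply,
        Equiv.swap_apply_left]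
    have h2 : φ (update v j (Complex.I • v j)) = -φ (update v' 0 (Complex.I • v' 0)) := by
      rw [← h1, hswap, neg_neg]
    rw [h2, apply_update_zero_I_smul_of_weight φ hφ v', hv', hswap]
    ring

end TopWeight

/-! ### The complex determinant form and the structure of top-weight forms -/

section Det

variable {E : Type*} [NormedAddCommGroup E] [NormedSpace ℂ E] [FiniteDimensional ℂ E] {n : ℕ}

/-- The determinant of a complex basis is continuous (a polynomial in the coordinates). [folklore] -/
theorem continuous_basis_cdet (e : Module.Basis (Fin n) ℂ E) : Continuous fun v : Fin n → E ↦ e.det v := by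
  simp_rw [Module.Basis.det_apply]
  refine Continuous.matrix_det ?_
  refine continuous_pi fun i ↦ continuous_pi fun j ↦ ?_
  simp only [Module.Basis.toMatrix_apply]
  exact (e.coord i).continuous_of_finiteDimensional.comp (continuous_apply j)

/-- **The complex determinant form of a complex basis as a real continuous alternating map**
`E [⋀^n]→L[ℝ] ℂ`: `dz₁ ∧ ⋯ ∧ dz_n` for the dual coordinates `z_i` of the basis (the generator of
`Λ^{n,0} E^*`, Voisin (2002), §2.3.1; Wells (1980), Ch. I §3), i.e. Mathlib's `Basis.det` with
scalars restricted to `ℝ` and made continuous (finite dimension). [cite: VoisinHodgeI2002, §2.3.1] -/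
def cdetL (e : Module.Basis (Fin n) ℂ E) : E [⋀^Fin n]→L[ℝ] ℂ :=
  { toContinuousMultilinearMap :=
      ⟨(e.det : E [⋀^Fin n]→ₗ[ℂ] ℂ).toMultilinearMap.restrictScalars ℝ, continuous_basis_cdet e⟩
    map_eq_zero_of_eq' := fun v _ _ h hij ↦ e.det.map_eq_zero_of_eq v h hij }

/-- `cdetL e v = e.det v` (definitional). [folklore] -/
@[simp]
theorem cdetL_apply (e : Module.Basis (Fin n) ℂ E) (v : Fin n → E) : cdetL e v = e.det v :=
  rfl

/-- `cdetL e e = 1`. [folklore] -/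
theorem cdetL_self (e : Module.Basis (Fin n) ℂ E) : cdetL e e = 1 := by
  simp [Module.Basis.det_self]

omit [FiniteDimensional ℂ E] in
/-- A real-multilinear form that is `ℂ`-linear in every slot for the scalar `i` is `ℂ`-linear in
every slot for all complex scalars (`c = re c + im c · i`). [folklore] -/
theorem map_update_smul_complex_of_forall_update_I (φ : E [⋀^Fin n]→L[ℝ] ℂ)
    (hI : ∀ (v : Fin n → E) (j : Fin n), φ (update v j (Complex.I • v j)) = Complex.I * φ v)
    (v : Fin n → E) (i : Fin n) (c : ℂ) (x : E) :
    φ (update v i (c • x)) = c • φ (update v i x) := by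
  have h1 : c • x = (c.re : ℝ) • x + (c.im : ℝ) • (Complex.I • x) := by
    conv_lhs => rw [← Complex.re_add_im c]
    rw [add_smul, mul_smul, Complex.coe_smul, Complex.coe_smul]
  have h2 := hI (update v i x) i
  rw [update_self, update_idem] at h2
  rw [h1, φ.map_update_add, φ.map_update_smul, φ.map_update_smul, h2, Complex.real_smul,
    Complex.real_smul, smul_eq_mul]
  conv_rhs => rw [← Complex.re_add_im c]
  ring

/-- **A real-alternating `n`-form which is `ℂ`-linear in every slot is a multiple of the complex
determinant**: `φ = φ(e) · det_e` (uniqueness of the complex volume form,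
`AlternatingMap.eq_smul_basis_det`, applied to `φ` upgraded to a `ℂ`-multilinear alternating map).
[folklore] -/
theorem eq_smul_cdetL_of_forall_update_I (φ : E [⋀^Fin n]→L[ℝ] ℂ)
    (hI : ∀ (v : Fin n → E) (j : Fin n), φ (update v j (Complex.I • v j)) = Complex.I * φ v)
    (e : Module.Basis (Fin n) ℂ E) : φ = φ e • cdetL e := by
  let ψ : E [⋀^Fin n]→ₗ[ℂ] ℂ :=
    { toFun := φ
      map_update_add' := fun v i x y ↦ φ.map_update_add v i x y
      map_update_smul' := fun v i c x ↦ by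
        convert map_update_smul_complex_of_forall_update_I φ hI v i c x
      map_eq_zero_of_eq' := fun v i j h hij ↦ φ.map_eq_zero_of_eq v h hij }
  have hψ : ∀ v, ψ v = φ v := fun v ↦ rfl
  have key := ψ.eq_smul_basis_det e
  ext v
  rw [← hψ, key, ContinuousAlternatingMap.smul_apply, cdetL_apply, AlternatingMap.smul_apply, hψ,
    smul_eq_mul]

/-- **Forms of top weight are multiples of the complex determinant.** On a complex vector space of
dimension `n`, a real-alternating complex-valued `n`-form `φ` of weight `n` under the rotations
`e^{iθ}` (i.e. of type `(n,0)`) is `φ = φ(e) · det_e` for every complex basis `e`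
(`Λ^{n,0} E^* = ℂ · dz₁ ∧ ⋯ ∧ dz_n`; Voisin (2002), §2.3.1, Wells (1980), Ch. I §3).
[cite: VoisinHodgeI2002, §2.3.1] -/
theorem eq_smul_cdetL_of_weight (φ : E [⋀^Fin n]→L[ℝ] ℂ)
    (hφ : ∀ (θ : ℝ) (v : Fin n → E), φ (fun i ↦ Complex.exp (θ * Complex.I) • v i) =
      Complex.exp ((n : ℂ) * θ * Complex.I) * φ v)
    (e : Module.Basis (Fin n) ℂ E) : φ = φ e • cdetL e := by
  cases n with
  | zero =>
    ext v
    rw [Subsingleton.elim v e, ContinuousAlternatingMap.smul_apply, cdetL_self, smul_eq_mul, mul_one]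
  | succ m =>
    exact eq_smul_cdetL_of_forall_update_I φ (apply_update_I_smul_of_weight φ hφ) e

end Det

/-! ### `det_e ∧ \overline{det_e} ≠ 0`: evaluation on the real basis `(e, ie)` -/

section WedgeDet

variable {n : ℕ}

/-- The permutation of `Fin (n + n)` acting as `π` on the first block and as `π'` on the second
(`Equiv.Perm.sumCongr` transported along `finSumFinEquiv`). [folklore] -/
def blockPerm (π π' : Equiv.Perm (Fin n)) : Equiv.Perm (Fin (n + n)) :=
  finSumFinEquiv.permCongr (π.sumCongr π')

/-- `blockPerm π π'` on the first block. [folklore] -/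
@[simp]
theorem blockPerm_castAdd (π π' : Equiv.Perm (Fin n)) (i : Fin n) :
    blockPerm π π' (Fin.castAdd n i) = Fin.castAdd n (π i) := by
  rw [blockPerm, Equiv.permCongr_apply, finSumFinEquiv_symm_apply_castAdd, Equiv.Perm.sumCongr_apply,
    Sum.map_inl, finSumFinEquiv_apply_left]

/-- `blockPerm π π'` on the second block. [folklore] -/
@[simp]
theorem blockPerm_natAdd (π π' : Equiv.Perm (Fin n)) (i : Fin n) :
    blockPerm π π' (Fin.natAdd n i) = Fin.natAdd n (π' i) := by
  rw [blockPerm, Equiv.permCongr_apply, finSumFinEquiv_symm_apply_natAdd, Equiv.Perm.sumCongr_apply,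
    Sum.map_inr, finSumFinEquiv_apply_right]

/-- `sign (blockPerm π π') = sign π · sign π'`. [folklore] -/
theorem sign_blockPerm (π π' : Equiv.Perm (Fin n)) :
    Equiv.Perm.sign (blockPerm π π') = Equiv.Perm.sign π * Equiv.Perm.sign π' := by
  simp [blockPerm, Equiv.Perm.sign_permCongr, Equiv.Perm.sign_sumCongr]

/-- **Generalised Laplace expansion along the first `n` rows, in permutation-sum form**: for a
`2n × 2n` matrix `Y`, summing over all column permutations `σ` the product of the Leibniz sums of
the two `n × n` blocks "rows `< n`, columns `σ(< n)`" and "rows `≥ n`, columns `σ(≥ n)`" gives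
`(n!)² det Y` (each column permutation `τ` of `det Y` arises from exactly `(n!)²` triples
`(σ, π, π')` through `τ = blockPerm π π' ∘ σ⁻¹`). [folklore] -/
theorem sum_perm_sign_smul_leibniz_blocks {R : Type*} [CommRing R]
    (Y : Matrix (Fin (n + n)) (Fin (n + n)) R) :
    ∑ σ : Equiv.Perm (Fin (n + n)), (Equiv.Perm.sign σ : ℤ) •
      ((∑ π : Equiv.Perm (Fin n), (Equiv.Perm.sign π : ℤ) •
          ∏ i, Y (Fin.castAdd n (π i)) (σ (Fin.castAdd n i))) *
        (∑ π' : Equiv.Perm (Fin n), (Equiv.Perm.sign π' : ℤ) •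
          ∏ i, Y (Fin.natAdd n (π' i)) (σ (Fin.natAdd n i)))) =
      ((n.factorial * n.factorial : ℕ) : R) * Y.det := by
  -- expand the product of sums and move the sum over `σ` inside
  have h1 : ∀ σ : Equiv.Perm (Fin (n + n)),
      (Equiv.Perm.sign σ : ℤ) •
        ((∑ π : Equiv.Perm (Fin n), (Equiv.Perm.sign π : ℤ) •
            ∏ i, Y (Fin.castAdd n (π i)) (σ (Fin.castAdd n i))) *
          (∑ π' : Equiv.Perm (Fin n), (Equiv.Perm.sign π' : ℤ) •
            ∏ i, Y (Fin.natAdd n (π' i)) (σ (Fin.natAdd n i)))) =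
      ∑ π : Equiv.Perm (Fin n), ∑ π' : Equiv.Perm (Fin n),
        ((Equiv.Perm.sign σ : ℤ) * Equiv.Perm.sign (blockPerm π π')) •
          ∏ p, Y (blockPerm π π' p) (σ p) := by
    intro σ
    rw [Finset.sum_mul_sum, Finset.smul_sum]
    refine Finset.sum_congr rfl fun π _ ↦ ?_
    rw [Finset.smul_sum]
    refine Finset.sum_congr rfl fun π' _ ↦ ?_
    rw [Fin.prod_univ_add, sign_blockPerm, Units.val_mul]
    simp only [blockPerm_castAdd, blockPerm_natAdd, zsmul_eq_mul]
    push_cast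
    ring
  simp only [h1]
  rw [Finset.sum_comm]
  simp only [Finset.sum_comm (γ := Equiv.Perm (Fin (n + n))) (α := Equiv.Perm (Fin n))]
  -- each inner sum over `σ` is `det Y`
  have h2 : ∀ π π' : Equiv.Perm (Fin n),
      ∑ σ : Equiv.Perm (Fin (n + n)),
        ((Equiv.Perm.sign σ : ℤ) * Equiv.Perm.sign (blockPerm π π')) •
          ∏ p, Y (blockPerm π π' p) (σ p) = Y.det := by
    intro π π'
    set ρ := blockPerm π π' with hρ
    rw [Matrix.det_apply]
    refine Fintype.sum_equiv ((Equiv.mulRight ρ⁻¹).trans (Equiv.inv _)) _ _ fun σ ↦ ?_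
    simp only [Equiv.trans_apply, Equiv.coe_mulRight, Equiv.inv_apply, mul_inv_rev, inv_inv,
      Units.smul_def, Equiv.Perm.sign_mul, Equiv.Perm.sign_inv, Units.val_mul, Equiv.Perm.coe_mul,
      Function.comp_apply]
    rw [mul_comm (Equiv.Perm.sign σ : ℤ)]
    congr 1
    exact (Finset.prod_congr rfl fun p _ ↦ by simp).trans
      (Equiv.prod_comp σ (fun q ↦ Y (ρ (σ⁻¹ q)) q))
  simp only [h2, Finset.sum_const, Finset.card_univ, Fintype.card_perm, Fintype.card_fin,
    nsmul_eq_mul]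
  push_cast
  ring

variable {E : Type*} [NormedAddCommGroup E] [NormedSpace ℂ E] [FiniteDimensional ℂ E]

/-- **`(det_e ∧ \overline{det_e})(e₁, …, e_n, ie₁, …, ie_n) = (-2i)^n`**: the wedge (shuffle
normalisation of the tree, Warner (1983), 2.10(b)) of the complex determinant form of a complex
basis `e` with its conjugate, evaluated on the real basis `(e, ie)`, is the determinant of the block
matrix `(1, i·1; 1, -i·1)`, i.e. `(-2i)^n ≠ 0` (in particular `dz ∧ dz̄ = -2i dx ∧ dy` for
`n = 1`). Proof: expand both determinants by Leibniz and regroup (`sum_perm_sign_smul_leibniz_blocks`).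
[folklore] -/
theorem wedge_cdetL_conj_apply_append (e : Module.Basis (Fin n) ℂ E) :
    ((cdetL e).wedge ((Complex.conjCLE : ℂ →L[ℝ] ℂ).compContinuousAlternatingMap (cdetL e)))
      (Fin.append e (fun j ↦ Complex.I • e j)) = (-2 * Complex.I) ^ n := by
  set b : Fin (n + n) → E := Fin.append e (fun j ↦ Complex.I • e j) with hb
  set Y : Matrix (Fin (n + n)) (Fin (n + n)) ℂ := fun p q ↦
    Fin.addCases (motive := fun _ ↦ ℂ) (fun t ↦ e.repr (b q) t)
      (fun t ↦ starRingEnd ℂ (e.repr (b q) t)) p with hY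
  have hYl : ∀ (t : Fin n) (q : Fin (n + n)), Y (Fin.castAdd n t) q = e.repr (b q) t := by
    intro t q; rw [hY]; exact Fin.addCases_left t
  have hYr : ∀ (t : Fin n) (q : Fin (n + n)),
      Y (Fin.natAdd n t) q = starRingEnd ℂ (e.repr (b q) t) := by
    intro t q; rw [hY]; exact Fin.addCases_right t
  rw [ContinuousAlternatingMap.wedge_apply]
  simp only [Units.smul_def]
  have hA : ∀ σ : Equiv.Perm (Fin (n + n)), cdetL e (fun i ↦ b (σ (Fin.castAdd n i))) =
      ∑ π : Equiv.Perm (Fin n), (Equiv.Perm.sign π : ℤ) •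
        ∏ i, Y (Fin.castAdd n (π i)) (σ (Fin.castAdd n i)) := by
    intro σ
    rw [cdetL_apply, Module.Basis.det_apply, Matrix.det_apply]
    refine Finset.sum_congr rfl fun π _ ↦ ?_
    rw [Units.smul_def]
    congr 1
    exact Finset.prod_congr rfl fun i _ ↦ by rw [Module.Basis.toMatrix_apply, hYl]
  have hB : ∀ σ : Equiv.Perm (Fin (n + n)),
      (Complex.conjCLE : ℂ →L[ℝ] ℂ).compContinuousAlternatingMap (cdetL e)
          (fun i ↦ b (σ (Fin.natAdd n i))) =
        ∑ π' : Equiv.Perm (Fin n), (Equiv.Perm.sign π' : ℤ) •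
          ∏ i, Y (Fin.natAdd n (π' i)) (σ (Fin.natAdd n i)) := by
    intro σ
    rw [ContinuousLinearMap.compContinuousAlternatingMap_coe, Function.comp_apply,
      ContinuousLinearEquiv.coe_coe, Complex.conjCLE_apply, cdetL_apply, Module.Basis.det_apply,
      Matrix.det_apply, map_sum]
    refine Finset.sum_congr rfl fun π' _ ↦ ?_
    rw [Units.smul_def, map_zsmul, map_prod]
    congr 1
    exact Finset.prod_congr rfl fun i _ ↦ by rw [Module.Basis.toMatrix_apply, hYr]
  simp only [hA, hB]
  rw [sum_perm_sign_smul_leibniz_blocks Y]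
  -- the block matrix
  have hYb : Y = Matrix.reindex finSumFinEquiv finSumFinEquiv
      (Matrix.fromBlocks 1 (Complex.I • (1 : Matrix (Fin n) (Fin n) ℂ)) 1
        ((-Complex.I) • (1 : Matrix (Fin n) (Fin n) ℂ))) := by
    ext p q
    rw [Matrix.reindex_apply, Matrix.submatrix_apply]
    rcases finSumFinEquiv.surjective p with ⟨t | t, rfl⟩ <;>
      rcases finSumFinEquiv.surjective q with ⟨j | j, rfl⟩ <;>
      simp only [finSumFinEquiv_symm_apply_castAdd, finSumFinEquiv_symm_apply_natAdd,
        finSumFinEquiv_apply_left, finSumFinEquiv_apply_right,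
        hYl, hYr, hb, Fin.append_left, Fin.append_right, Matrix.fromBlocks_apply₁₁,
        Matrix.fromBlocks_apply₁₂, Matrix.fromBlocks_apply₂₁, Matrix.fromBlocks_apply₂₂,
        map_smul, Finsupp.smul_apply, Module.Basis.repr_self_apply, Matrix.smul_apply,
        Matrix.one_apply, smul_eq_mul] <;>
      by_cases h : t = j <;> simp [h, eq_comm]
  rw [hYb, Matrix.det_reindex_self, Matrix.det_fromBlocks_one₁₁, Matrix.one_mul, ← sub_smul,
    Matrix.det_smul, Matrix.det_one, Fintype.card_fin, mul_one, Complex.real_smul]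
  push_cast
  have hn : (n.factorial : ℂ) ≠ 0 := by exact_mod_cast Nat.factorial_ne_zero n
  field_simp
  ring

/-- `det_e ∧ \overline{det_e} ≠ 0` (it takes the value `(-2i)^n` on `(e, ie)`). [folklore] -/
theorem wedge_cdetL_conj_ne_zero (e : Module.Basis (Fin n) ℂ E) :
    (cdetL e).wedge ((Complex.conjCLE : ℂ →L[ℝ] ℂ).compContinuousAlternatingMap (cdetL e)) ≠ 0 := by
  intro h
  have := wedge_cdetL_conj_apply_append e
  rw [h, ContinuousAlternatingMap.coe_zero, Pi.zero_apply] at this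
  exact pow_ne_zero n (mul_ne_zero (by norm_num) Complex.I_ne_zero) this.symm

end WedgeDet

/-! ### The positive top form `Re(c₀ · φ ∧ φ̄)` of a top-weight form `φ` -/

section Positivity

variable {E : Type*} [NormedAddCommGroup E] [NormedSpace ℂ E] {k l n : ℕ}

/-- The wedge of complex-valued real forms commutes with complex scalars on the left (shuffle
formula; the tree's `wedge_smul_left` is for real scalars). [folklore] -/
theorem wedge_smul_left_complex (c : ℂ) (α : E [⋀^Fin k]→L[ℝ] ℂ) (β : E [⋀^Fin l]→L[ℝ] ℂ) :
    (c • α).wedge β = c • α.wedge β := by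
  ext v
  simp only [ContinuousAlternatingMap.wedge_apply, ContinuousAlternatingMap.smul_apply, smul_eq_mul,
    Finset.mul_sum, Finset.smul_sum]
  refine Finset.sum_congr rfl fun σ _ ↦ ?_
  simp only [Units.smul_def, zsmul_eq_mul, Complex.real_smul]
  ring

/-- The wedge of complex-valued real forms commutes with complex scalars on the right. [folklore] -/
theorem wedge_smul_right_complex (c : ℂ) (α : E [⋀^Fin k]→L[ℝ] ℂ) (β : E [⋀^Fin l]→L[ℝ] ℂ) :
    α.wedge (c • β) = c • α.wedge β := by
  ext v
  simp only [ContinuousAlternatingMap.wedge_apply, ContinuousAlternatingMap.smul_apply, smul_eq_mul,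
    Finset.mul_sum, Finset.smul_sum]
  refine Finset.sum_congr rfl fun σ _ ↦ ?_
  simp only [Units.smul_def, zsmul_eq_mul, Complex.real_smul]
  ring

/-- Conjugation of complex-valued real forms is conjugate-linear. [folklore] -/
theorem conjCLE_compContinuousAlternatingMap_smul (c : ℂ) (α : E [⋀^Fin k]→L[ℝ] ℂ) :
    (Complex.conjCLE : ℂ →L[ℝ] ℂ).compContinuousAlternatingMap (c • α) =
      starRingEnd ℂ c • (Complex.conjCLE : ℂ →L[ℝ] ℂ).compContinuousAlternatingMap α := by
  ext v
  simp

/-- A real scalar acts on complex-valued real forms in the same way through `ℝ ⊆ ℂ`. [folklore] -/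
theorem ofReal_smul_continuousAlternatingMap (r : ℝ) (α : E [⋀^Fin k]→L[ℝ] ℂ) :
    (r : ℂ) • α = r • α := by
  ext v
  simp

/-- Taking real parts of complex-valued real forms is real-linear. [folklore] -/
theorem reCLM_compContinuousAlternatingMap_smul (r : ℝ) (α : E [⋀^Fin k]→L[ℝ] ℂ) :
    Complex.reCLM.compContinuousAlternatingMap (r • α) =
      r • Complex.reCLM.compContinuousAlternatingMap α := by
  ext v
  simp

variable [FiniteDimensional ℂ E]

/-- **Scaling of `Re(c₀ · φ ∧ φ̄)` for `φ = a · det_e`**: it is `|a|²` times `Re(c₀ · det_e ∧ \overline{det_e})`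
(sesquilinearity of `(φ, ψ) ↦ φ ∧ ψ̄`). With `eq_smul_cdetL_of_weight` this exhibits, for forms of
type `(n,0)`, the real top form `Re(c₀ φ ∧ φ̄)` as a nonnegative multiple of one fixed top form
(the pointwise positivity `i^{n²} η ∧ η̄ ≥ 0` behind Voisin (2002), proof of Cor. 7.6 for `p = n` /
Lemma 6.9). [cite: VoisinHodgeI2002, §2.3.1] -/
theorem reCLM_wedge_conj_smul_cdetL (e : Module.Basis (Fin n) ℂ E) (c₀ a : ℂ) :
    Complex.reCLM.compContinuousAlternatingMap
        (c₀ • ((a • cdetL e).wedge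
          ((Complex.conjCLE : ℂ →L[ℝ] ℂ).compContinuousAlternatingMap (a • cdetL e)))) =
      Complex.normSq a • Complex.reCLM.compContinuousAlternatingMap
        (c₀ • ((cdetL e).wedge
          ((Complex.conjCLE : ℂ →L[ℝ] ℂ).compContinuousAlternatingMap (cdetL e)))) := by
  rw [conjCLE_compContinuousAlternatingMap_smul, wedge_smul_left_complex, wedge_smul_right_complex,
    smul_smul, smul_smul, mul_assoc, Complex.mul_conj, mul_comm c₀, ← smul_smul,
    ofReal_smul_continuousAlternatingMap, reCLM_compContinuousAlternatingMap_smul]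

/-- **Positivity of the reference top form on the real basis `(e, ie)`**: with
`c₀ = \overline{(det_e ∧ \overline{det_e})(e, ie)}`, the real top form `Re(c₀ · det_e ∧ \overline{det_e})`
takes the value `|(-2i)^n|² = 4^n > 0` there. [folklore] -/
theorem reCLM_wedge_conj_cdetL_apply_append_pos (e : Module.Basis (Fin n) ℂ E) :
    0 < Complex.reCLM.compContinuousAlternatingMap
        (starRingEnd ℂ ((-2 * Complex.I) ^ n) • ((cdetL e).wedge
          ((Complex.conjCLE : ℂ →L[ℝ] ℂ).compContinuousAlternatingMap (cdetL e))))
        (Fin.append e (fun j ↦ Complex.I • e j)) := by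
  rw [ContinuousLinearMap.compContinuousAlternatingMap_coe, Function.comp_apply,
    ContinuousAlternatingMap.smul_apply, wedge_cdetL_conj_apply_append, Complex.reCLM_apply,
    smul_eq_mul, ← Complex.normSq_eq_conj_mul_self]
  exact_mod_cast Complex.normSq_pos.2 (pow_ne_zero n (mul_ne_zero (by norm_num) Complex.I_ne_zero))

end Positivity


end Literature.NumberTheory.Transcendental
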